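import Literature.MathematicalPhysics.QuantumFieldTheory.Balaban1983to89.B7Prop5GeneralLinear
import Literature.MathematicalPhysics.QuantumFieldTheory.Balaban1983to89.B7Ineq139PathMass

/-!
# `Balaban1983to89.B7Prop5CplxLinear` — T. Bałaban, *Averaging operations for lattice gauge theories*, Commun. Math. Phys.
**98** (1985) 17–51 [Balaban1985Averaging]: Proposition 5 EXTENDED TO THE COMPLEX BACKGROUND `U′U₀` (p. 43 «Similarly,
Proposition 5 may be extended to include analyticity and uniformity statements. The formulations are obvious.») — file 2/5:
the induction (143)–(147) for the composed linear part `Q_j(W)` with LEVEL-DEPENDENT one-step majorants (139)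

statement-level skeleton of published theorems with citation tags; proofs where landed; nothing here is a claim about the Yang–Mills mass gap

PDF held: `paper:balaban1985-cmp98-averaging` (journal page = PDF page + 16); pp. 39–40 [PDF 23–24] ((139)–(147)) and p. 43
[PDF 27] (Prop. 7 and the sentence after it) read from the materialised text layer
`~/.lit/texts/paper-balaban1985-cmp98-averaging/p0023.txt`, `p0024.txt`, `p0027.txt`.

CITATION HEADER / WHAT IS REPRODUCED.  SKELETON row **B7.Prop7** (cell `lit-balaban`, HOME `run/shared/lean/pub/lit-balaban/`,
seat p06 gen 4 = unit `lit-balaban-p06`; B7 owner r04, referee ref-4), located qualifier of ROWS-B7 v3.7: «the Prop. 5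
extension (‘Similarly, Proposition 5 may be extended …’) not typed».  p. 43, verbatim: *"… we repeat the reasoning connected
with Proposition 4, but with Ū₀ʲ replaced by \overline{U′U₀}ʲ = Ũ′ʲŪ₀ʲ. Because of the bound (164), we have to replace the
factors e^{O(1)L^{2(j+1)}η²α₀} by e^{O(1)(L^{2(j+1)}η²α₀ + L^{j+1}ηα₁)}, but this change is easily incorporated into the
considerations and the estimates. We get the same results as before for α₀, α₁ sufficiently small, uniformly in A′ … Similarly,
Proposition 5 may be extended to include analyticity and uniformity statements. The formulations are obvious."*  pp. 39–40:
*"|Q_{V₀}A| ≦ Q|A|, |Q″(V₀)A| ≦ C′₁L²α₀Q″|A|, (139) … Now we will prove by induction the bound |Q_j(U₀)A| ≦ Q_j|A| +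
2C′₁α₀(Lʲη)²Q″_j|A|, j ≦ k, (143) … |Q_{j+1}(U₀)A| = |Q(Ū₀ʲ)Q_j(U₀)A| ≦ Q|Q_j(U₀)A| + C′₁2α₀(Lʲη)²Q″|Q_j(U₀)A| … (144) by (139)
and Proposition 2. Further using the inequalities (142), QQ″_j|A| ≦ 2Q″_{j+1}|A|, and Q″Q_j|A| ≦ Q″_{j+1}|A|, we get … (145) …
For j = k we have |Q_k(U₀)A| ≦ Q_k|A| + 2C′₁α₀Q″_k|A| ≦ (1 + 2C′₁α₀)Q″_k|A|, (146) and this bound implies the required property,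
namely (δ/δA_b)(Q_k(U₀)A)_c = Q_k(U₀; c, b), |Q_k(U₀; c, b)| ≦ 1 + 2C′₁α₀. (147)"*

THE PRINTED ROUTE, FOLLOWED — AND WHY A NEW FILE.  `B7Prop5GeneralLinear.ineq143/ineq147` prove (143)–(147) per bond at a
general background from the one-step majorant (139) in the shape `Q|·| + θ·(Lʲη)²·L·Q″|·|` whose level weight `(Lʲη)² =
(Lʲ/Lᵏ)²` is HARD-WIRED (the `L^{2(j+1)}η²α₀` of print).  At the complex level backgrounds `Ũ′ʲŪ₀ʲ` the one-step majorant
carries the additional weight `L^{j+1}ηα₁` of print (the transports by the non-unitary `Ũ′ʲ` cost a factor `1 + O(Lʲηα₁·L)` on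
the main term `Q|·|` as well), which is NOT `≦ const·(Lʲη)²` uniformly in `k`.  This file therefore re-runs the printed induction
(144)–(145) with the one-step majorant in the three-term shape
  `‖L(Q(W̄ʲ)G)_c‖ ≤ (1 + ε_j)·(L·Q|G|)_c + τ_j·L·(Q″|G|)_c`                                             (139)ⱼ
for ARBITRARY non-negative level sequences `ε_j` (transport excess), `τ_j` (the `Q″`-coefficient) and a cumulative sequence
`Θ_j` (the coefficient of `Q″_j` in (143)ⱼ) tied by the STEP CONDITION
  `(1 + ε_j)·Θ_j·(2L − 1) + ε_j·L + τ_j·L·(1 + 2d·Θ_j) ≤ Θ_{j+1}·L`                                     (145)ⱼ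
— print's «this change is easily incorporated into the considerations and the estimates»: (144) with the factor `(1+ε_j)` on
`Q|Q_j(W)A|`, the excess `ε_jQ_{j+1}|A| ≦ ε_jLʲ⁺¹ηQ″_{j+1}|A|` («Q_k ≦ Q″_k», as in (146)) joining the `Q″`-terms, then «QQ_j =
Q_{j+1}», «QQ″_j ≦ (2 − L⁻¹)Q″_{j+1}», «Q″Q_j ≦ Q″_{j+1}», (142) exactly as before.  `B7Prop5GeneralLinear.ineq143` is the case
`ε_j = 0`, `τ_j = Θ_j = θ(Lʲ/Lᵏ)²` (its `h145` is (145)ⱼ: `θs(2L−1) + θsL(1+2dθs) ≤ θL²s·L`, `B7Prop5GeneralLinear.ineq145_arith`).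
The choice of the sequences at `W = U′U₀` and the verification of (145)ⱼ under «α₀, α₁ sufficiently small» is file 5
(`B7Prop5Cplx`); the one-step majorants at `Ũ′ʲŪ₀ʲ` are files 1 and 4 (`B7Ineq139Cplx`, `B7Prop5CplxLevels`).

DICTIONARY (as in `B7Prop5GeneralLinear`; every level rescaled to `ℤᵈ`, `B = ηA`): `LʲηQ_j(W)A ↦ linCovIter L W B j`
(`B7Prop4GeneralLevels`), `A ↦ X·δ_b`, `b = ⟨y, y + e_μ⟩` `↦ bump y μ X`, the columns `Q_j(·; c, b) ↦ kerQ L j`, `Q″_j(·; c, b) ↦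
kerQdd L j` (`B7Prop5GeneralOperators`), `L·Q ↦ avQ L`, `Q″ ↦ ddQ L`; (143)ⱼ `↦ ‖linCovIter L W (bump y μ X) j c‖ ≤ (kerQ L j c b +
Θ_j·Lʲ·kerQdd L j c b)·‖X‖`.  The background `W : Site d → Fin d → 𝔸ˣ` is ANY unit-valued configuration (at `W = e^{B′}U₀`
the level backgrounds `avgIter L W j` are `Ũ′ʲŪ₀ʲ`, `B7Eq92Concrete.tildIter_mul`).

WHAT THIS FILE PROVES (kernel, 0 sorry, theorems only), for `L ≥ 2`:
* §1 `avQ_norm_le_ddQ` («Q|G| ≦ LᵈQ″|G|» — every straight segment of (125) lies in `B(c₋) ∪ B(c₊)`; the crude form of «Q_k ≦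
  Q″_k»), `h139_two_of_three` (the three-term majorant implies the two-term one of `B7Prop5GeneralLinear` §2 with `e₁ =
  ε·Lᵈ + τ·L` — so LOCALITY `linQcov_local` and `hasDerivAt_linQcov_family` are available at every complex level background);
* §2 **`ineq143_cplx`** = (143)ⱼ for all `j ≤ k` per bond under (139)ⱼ and (145)ⱼ; **`ineq147_cplx`** = (146)/(147):
  `‖LʲηQ_j(W)(Xδ_b)(c)‖ ≤ (1 + Θ_j)·Lʲ·L^{−jd}·‖X‖` («|Q_k(U′U₀; c, b)| ≦ 1 + 2C′₁α₀» with `2C′₁α₀ ↦ Θ_k`); `linCovIter_bump_eq_zero_cplx`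
  (locality: zero unless `b ⊂ Bʲ(c₋) ∪ Bʲ(c₊)`).
DIVERGENCES from print: the sharp «(2 − L⁻¹)» for print's «2» in «QQ″_j ≦ 2Q″_{j+1}» (as in `B7Prop5GeneralLinear`); the step
condition is displayed as a hypothesis on the sequences (print: «easily incorporated»); `ℤᵈ`, corner blocks, un-normalised
currency as in the lineage.  REUSED BY NAME: `B7Prop5GeneralLinear.linCovIter_line / hasDerivAt_linCovIter_line` (background-
generic), `B7Prop5GeneralOperatorFacts.avQ_kerQ / avQ_kerQdd_le / ddQ_kerQ_le / ddQ_kerQdd_le`, `B7Prop5GeneralOperators.kerQ_le /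
kerQdd_le / kerQ_zero`, `B7Ineq139PathMass.sum_pathMass_seg_eq_avQ / pathMass_seg_le / sum_S1_eq_ddQ`.
-/

noncomputable section

open scoped BigOperators
open Finset

namespace Literature.MathematicalPhysics.QuantumFieldTheory.Balaban1983to89.B7Prop5CplxLinear

open B7Prop1Explicit B7Prop1Local B7Prop2Explicit B7Prop3Flat B7Prop4Flat B7Prop5Flat B7Eq92Concrete B7Prop3GeneralLinear
  B7Prop4GeneralLevels B7Prop5GeneralOperators B7Prop5GeneralOperatorFacts B7Prop5GeneralLinear B7Ineq139PathMass

export B7Prop1Explicit (Site)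

variable {d : ℕ} {𝔸 : Type*} [NormedRing 𝔸] [NormedAlgebra ℂ 𝔸] [CompleteSpace 𝔸]

/-! ## §1 «Q ≦ LᵈQ″» on the two blocks; the three-term majorant implies the two-term one -/

omit [NormedAlgebra ℂ 𝔸] [CompleteSpace 𝔸] in
/-- **«Q|G| ≦ Lᵈ·Q″|G|» on `B(c₋) ∪ B(c₊)`** (un-normalised: `avQ L |G| (c) ≤ Lᵈ·ddQ L |G| (c)`): every straight segment `[x, x(c)]`
of the block average (125) lies in the two blocks, so its mass is at most the two-block mass (140) (`pathMass_seg_le`), and the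
segment masses sum to `avQ` exactly (`sum_pathMass_seg_eq_avQ`) — the crude operator form of «Q_k ≦ Q″_k» used in (146).
[cite: Balaban1985Averaging, (139)–(140) p.39, (146) p.40] -/
theorem avQ_norm_le_ddQ (L : ℕ) (hL : 1 ≤ L) (G : Site d → Fin d → 𝔸) (q : Site d) (κ : Fin d) :
    avQ L (fun x μ => ‖G x μ‖) q κ ≤ (L : ℝ) ^ d * ddQ L (fun x μ => ‖G x μ‖) q κ := by
  have hL0 : 0 < L := hL
  have hLr : (0 : ℝ) < L := by exact_mod_cast hL0
  set S : ℝ := ∑ b ∈ S1 L q κ, ‖G b.1 b.2‖ with hS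
  rw [← sum_pathMass_seg_eq_avQ L hL0 G q κ, ← sum_S1_eq_ddQ L hL0 G q κ]
  calc (L : ℝ) * ∑ r : Fin d → Fin L, ((L : ℝ) ^ (d + 1))⁻¹ * pathMass G (q + boxVec L r) (seg κ (L : ℤ))
      ≤ (L : ℝ) * ∑ _r : Fin d → Fin L, ((L : ℝ) ^ (d + 1))⁻¹ * S :=
        mul_le_mul_of_nonneg_left (sum_le_sum fun r _ =>
          mul_le_mul_of_nonneg_left (pathMass_seg_le L G q κ r) (by positivity)) hLr.le
    _ = S := by
        rw [sum_const, card_univ, Fintype.card_pi, prod_const, card_univ, Fintype.card_fin, Fintype.card_fin,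
          nsmul_eq_mul, Nat.cast_pow, pow_succ]
        field_simp

/-- **the three-term one-step majorant implies the two-term one**: from `‖L(Q(W)G)_c‖ ≤ (1+ε)·avQ L |G| (c) + τ·L·ddQ L |G| (c)`
and «Q ≦ LᵈQ″» we get `‖L(Q(W)G)_c‖ ≤ avQ L |G| (c) + (ε·Lᵈ + τ·L)·ddQ L |G| (c)` — the hypothesis shape `h139` of
`B7Prop5GeneralLinear` §2 (`linQcov_local`, `isBoundedLinearMap_linQcov_ins`, `hasDerivAt_linQcov_family`), which are thus available
at every complex level background. [cite: Balaban1985Averaging, (139)–(140) p.39, Proposition 7 p.43] -/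
theorem h139_two_of_three (L : ℕ) (hL : 1 ≤ L) (W : Site d → Fin d → 𝔸ˣ) (q : Site d) (κ : Fin d) {ε τ : ℝ} (hε : 0 ≤ ε)
    (h : ∀ G : Site d → Fin d → 𝔸, ‖linQcov L W G q κ‖ ≤
      (1 + ε) * avQ L (fun x κ' => ‖G x κ'‖) q κ + τ * (L : ℝ) * ddQ L (fun x κ' => ‖G x κ'‖) q κ) :
    ∀ G : Site d → Fin d → 𝔸, ‖linQcov L W G q κ‖ ≤
      avQ L (fun x κ' => ‖G x κ'‖) q κ + (ε * (L : ℝ) ^ d + τ * (L : ℝ)) * ddQ L (fun x κ' => ‖G x κ'‖) q κ := by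
  intro G
  have h1 := h G
  have h2 := mul_le_mul_of_nonneg_left (avQ_norm_le_ddQ L hL G q κ) hε
  calc ‖linQcov L W G q κ‖
      ≤ (1 + ε) * avQ L (fun x κ' => ‖G x κ'‖) q κ + τ * (L : ℝ) * ddQ L (fun x κ' => ‖G x κ'‖) q κ := h1
    _ = avQ L (fun x κ' => ‖G x κ'‖) q κ + ε * avQ L (fun x κ' => ‖G x κ'‖) q κ
          + τ * (L : ℝ) * ddQ L (fun x κ' => ‖G x κ'‖) q κ := by ring
    _ ≤ avQ L (fun x κ' => ‖G x κ'‖) q κ + ε * ((L : ℝ) ^ d * ddQ L (fun x κ' => ‖G x κ'‖) q κ)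
          + τ * (L : ℝ) * ddQ L (fun x κ' => ‖G x κ'‖) q κ := by linarith
    _ = _ := by ring

/-! ## §2 (143)–(147) per bond with level-dependent one-step majorants -/

section Levels

variable (L : ℕ) (hL : 2 ≤ L) (W : Site d → Fin d → 𝔸ˣ) (k : ℕ) {ε τ Θ : ℕ → ℝ} (hε : ∀ j, 0 ≤ ε j)
  (hτ : ∀ j, 0 ≤ τ j) (hΘ : ∀ j, 0 ≤ Θ j)
  (h139 : ∀ j < k, ∀ (G : Site d → Fin d → 𝔸) (z : Site d) (κ : Fin d),
    ‖linQcov L (avgIter L W j) G ((L : ℤ) • z) κ‖ ≤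
      (1 + ε j) * avQ L (fun x κ' => ‖G x κ'‖) ((L : ℤ) • z) κ
        + τ j * (L : ℝ) * ddQ L (fun x κ' => ‖G x κ'‖) ((L : ℤ) • z) κ)
  (hstep : ∀ j < k, (1 + ε j) * Θ j * (2 * (L : ℝ) - 1) + ε j * (L : ℝ) + τ j * (L : ℝ) * (1 + 2 * d * Θ j) ≤ Θ (j + 1) * (L : ℝ))

include hL hε hτ hΘ h139 hstep in
/-- **(143) WITH LEVEL-DEPENDENT MAJORANTS, FOR ALL `j ≤ k`, PER BOND** — the printed induction (144)–(145) at the backgrounds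
`W̄ʲ = avgIter L W j` (`= Ũ′ʲŪ₀ʲ` at `W = U′U₀`): for the single-bond direction `X·δ_b`, `b = ⟨y, y + e_μ⟩`, and every bond `c` of
the `j`-th lattice, `‖LʲηQ_j(W)(X·δ_b)(c)‖ ≤ (kerQ(c, b) + Θ_j·Lʲ·kerQdd(c, b))·‖X‖` — «|Q_j(·)A| ≦ Q_j|A| + Θ_jQ″_j|A|» column by
column.  Base `j = 0`: `Q_0 = 1`.  Step: (139)ⱼ (`h139`, three terms), the excess `ε_j·Q_{j+1}|A| ≦ ε_jL^{j+1}·Q″_{j+1}|A|` per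
column (`kerQ_le`), «QQ_j = Q_{j+1}», «QQ″_j ≦ (2 − L⁻¹)Q″_{j+1}», «Q″Q_j ≦ Q″_{j+1}», (142) (`B7Prop5GeneralOperatorFacts`), and the
step condition (145)ⱼ (`hstep`) — print's «this change is easily incorporated into the considerations and the estimates».
[cite: Balaban1985Averaging, (143)–(145) pp.39–40, Proposition 7 p.43] -/
theorem ineq143_cplx (y : Site d) (μ : Fin d) (X : 𝔸) :
    ∀ j ≤ k, ∀ (x : Site d) (κ : Fin d),
      ‖linCovIter L W (bump y μ X) j x κ‖ ≤
        (kerQ L j x κ y μ + Θ j * (L : ℝ) ^ j * kerQdd L j x κ y μ) * ‖X‖ := by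
  have hL1 : 1 ≤ L := le_trans (by norm_num) hL
  have hLr : (2 : ℝ) ≤ L := by exact_mod_cast hL
  have hLpos : (0 : ℝ) < L := by linarith
  intro j
  induction j with
  | zero =>
    intro _ x κ
    rw [linCovIter_zero, kerQ_zero]
    have hdd := kerQdd_nonneg L 0 x κ y μ
    have hΘ0 := hΘ 0
    by_cases h : x = y ∧ κ = μ
    · rw [if_pos h]
      have hb : ‖bump y μ X x κ‖ = ‖X‖ := by simp [bump, h]
      rw [hb]
      have : 0 ≤ Θ 0 * (L : ℝ) ^ 0 * kerQdd L 0 x κ y μ * ‖X‖ := by positivity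
      nlinarith
    · rw [if_neg h, bump_eq_zero_of X h, norm_zero]
      positivity
  | succ j ih =>
    intro hjk z κ
    have hj : j < k := Nat.lt_of_succ_le hjk
    set G := linCovIter L W (bump y μ X) j with hG
    set C : ℝ := Θ j * (L : ℝ) ^ j * ‖X‖ with hC
    have hC0 : 0 ≤ C := by have := hΘ j; positivity
    have hGb : ∀ x κ', ‖G x κ'‖ ≤ ‖X‖ * kerQ L j x κ' y μ + C * kerQdd L j x κ' y μ := fun x κ' => by
      have := ih hj.le x κ'
      rw [hC]; linarith [this]
    set V := kerQdd L (j + 1) z κ y μ with hV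
    have hV0 : 0 ≤ V := kerQdd_nonneg L (j + 1) z κ y μ
    -- `Q` through (143)ⱼ: «QQ_j = Q_{j+1}», «QQ″_j ≤ (2 − L⁻¹)Q″_{j+1}»
    have hav : avQ L (fun x κ' => ‖G x κ'‖) ((L : ℤ) • z) κ ≤
        ‖X‖ * kerQ L (j + 1) z κ y μ + C * ((2 * (L : ℝ) - 1) * V) := by
      calc avQ L (fun x κ' => ‖G x κ'‖) ((L : ℤ) • z) κ
          ≤ avQ L (fun x κ' => ‖X‖ * kerQ L j x κ' y μ + C * kerQdd L j x κ' y μ) ((L : ℤ) • z) κ := avQ_mono L hGb _ _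
        _ = ‖X‖ * avQ L (fun x κ' => kerQ L j x κ' y μ) ((L : ℤ) • z) κ
              + C * avQ L (fun x κ' => kerQdd L j x κ' y μ) ((L : ℤ) • z) κ := by
            rw [avQ_add, avQ_smul, avQ_smul]
        _ ≤ _ := by
            rw [avQ_kerQ]
            exact add_le_add le_rfl (mul_le_mul_of_nonneg_left (avQ_kerQdd_le L hL1 j z κ y μ) hC0)
    -- `Q″` through (143)ⱼ: «Q″Q_j ≤ Q″_{j+1}», (142)
    have hdd : ddQ L (fun x κ' => ‖G x κ'‖) ((L : ℤ) • z) κ ≤ ‖X‖ * ((L : ℝ) ^ j * V) + C * (2 * d * V) := by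
      calc ddQ L (fun x κ' => ‖G x κ'‖) ((L : ℤ) • z) κ
          ≤ ddQ L (fun x κ' => ‖X‖ * kerQ L j x κ' y μ + C * kerQdd L j x κ' y μ) ((L : ℤ) • z) κ := ddQ_mono L hGb _ _
        _ = ‖X‖ * ddQ L (fun x κ' => kerQ L j x κ' y μ) ((L : ℤ) • z) κ
              + C * ddQ L (fun x κ' => kerQdd L j x κ' y μ) ((L : ℤ) • z) κ := by
            rw [ddQ_add, ddQ_smul, ddQ_smul]
        _ ≤ _ := add_le_add (mul_le_mul_of_nonneg_left (ddQ_kerQ_le L hL1 j z κ y μ) (norm_nonneg X))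
              (mul_le_mul_of_nonneg_left (ddQ_kerQdd_le L hL1 j z κ y μ) hC0)
    -- the excess of the main term: «Q_{j+1} ≤ L^{j+1}Q″_{j+1}» per column
    have hQQ : kerQ L (j + 1) z κ y μ ≤ (L : ℝ) ^ (j + 1) * V := kerQ_le L (j + 1) z κ y μ
    -- (144)–(145)
    have h1 := h139 j hj G z κ
    have hεj := hε j
    have hτj := hτ j
    have hΘj := hΘ j
    have hstepj := hstep j hj
    have h1ε : 0 ≤ 1 + ε j := by linarith
    have hτL : 0 ≤ τ j * (L : ℝ) := by positivity
    rw [linCovIter_succ]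
    have hav' : (1 + ε j) * avQ L (fun x κ' => ‖G x κ'‖) ((L : ℤ) • z) κ
        ≤ ‖X‖ * kerQ L (j + 1) z κ y μ + ε j * (‖X‖ * ((L : ℝ) ^ (j + 1) * V))
          + (1 + ε j) * (C * ((2 * (L : ℝ) - 1) * V)) := by
      have e1 := mul_le_mul_of_nonneg_left hav h1ε
      have e2 : ε j * (‖X‖ * kerQ L (j + 1) z κ y μ) ≤ ε j * (‖X‖ * ((L : ℝ) ^ (j + 1) * V)) :=
        mul_le_mul_of_nonneg_left (mul_le_mul_of_nonneg_left hQQ (norm_nonneg X)) hεj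
      calc (1 + ε j) * avQ L (fun x κ' => ‖G x κ'‖) ((L : ℤ) • z) κ
          ≤ (1 + ε j) * (‖X‖ * kerQ L (j + 1) z κ y μ + C * ((2 * (L : ℝ) - 1) * V)) := e1
        _ = ‖X‖ * kerQ L (j + 1) z κ y μ + ε j * (‖X‖ * kerQ L (j + 1) z κ y μ)
              + (1 + ε j) * (C * ((2 * (L : ℝ) - 1) * V)) := by ring
        _ ≤ _ := by linarith
    have key : (L : ℝ) ^ j * ‖X‖ * V *
        ((1 + ε j) * Θ j * (2 * (L : ℝ) - 1) + ε j * (L : ℝ) + τ j * (L : ℝ) * (1 + 2 * d * Θ j))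
        ≤ (L : ℝ) ^ j * ‖X‖ * V * (Θ (j + 1) * (L : ℝ)) :=
      mul_le_mul_of_nonneg_left hstepj (by positivity)
    calc ‖linQcov L (avgIter L W j) G ((L : ℤ) • z) κ‖
        ≤ (1 + ε j) * avQ L (fun x κ' => ‖G x κ'‖) ((L : ℤ) • z) κ
            + τ j * (L : ℝ) * ddQ L (fun x κ' => ‖G x κ'‖) ((L : ℤ) • z) κ := h1
      _ ≤ (‖X‖ * kerQ L (j + 1) z κ y μ + ε j * (‖X‖ * ((L : ℝ) ^ (j + 1) * V))
              + (1 + ε j) * (C * ((2 * (L : ℝ) - 1) * V)))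
            + τ j * (L : ℝ) * (‖X‖ * ((L : ℝ) ^ j * V) + C * (2 * d * V)) :=
          add_le_add hav' (mul_le_mul_of_nonneg_left hdd hτL)
      _ = ‖X‖ * kerQ L (j + 1) z κ y μ
            + (L : ℝ) ^ j * ‖X‖ * V *
              ((1 + ε j) * Θ j * (2 * (L : ℝ) - 1) + ε j * (L : ℝ) + τ j * (L : ℝ) * (1 + 2 * d * Θ j)) := by
          rw [hC, pow_succ]; ring
      _ ≤ ‖X‖ * kerQ L (j + 1) z κ y μ + (L : ℝ) ^ j * ‖X‖ * V * (Θ (j + 1) * (L : ℝ)) := add_le_add le_rfl key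
      _ = (kerQ L (j + 1) z κ y μ + Θ (j + 1) * (L : ℝ) ^ (j + 1) * V) * ‖X‖ := by rw [pow_succ]; ring

include hL hε hτ hΘ h139 hstep in
/-- **(146)/(147) WITH LEVEL-DEPENDENT MAJORANTS, PER BOND**: `‖LʲηQ_j(W)(X·δ_b)(c)‖ ≤ (1 + Θ_j)·Lʲ·L^{−jd}·‖X‖` — «|Q_k(·)A| ≦
Q_k|A| + Θ_kQ″_k|A| ≦ (1 + Θ_k)Q″_k|A|» and «|Q_k(U′U₀; c, b)| ≦ 1 + Θ_k» (at `j = k`, `Lᵏη = 1`; «Q_k ≦ Q″_k» per column =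
`kerQ_le`) — (147) at the complex background «uniformly in A′» once `Θ_k` is `A′`-independent (file 5).
[cite: Balaban1985Averaging, (146)–(147) p.40, Proposition 7 p.43] -/
theorem ineq147_cplx (y : Site d) (μ : Fin d) (X : 𝔸) {j : ℕ} (hj : j ≤ k) (x : Site d) (κ : Fin d) :
    ‖linCovIter L W (bump y μ X) j x κ‖ ≤ (1 + Θ j) * ((L : ℝ) ^ j * (((L : ℝ) ^ j) ^ d)⁻¹) * ‖X‖ := by
  have h := ineq143_cplx L hL W k hε hτ hΘ h139 hstep y μ X j hj x κ
  have h1 := kerQ_le L j x κ y μ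
  have h2 := kerQdd_le L j x κ y μ
  have h3 := kerQdd_nonneg L j x κ y μ
  have hΘj := hΘ j
  refine h.trans (mul_le_mul_of_nonneg_right ?_ (norm_nonneg X))
  have hLj : (0 : ℝ) ≤ (L : ℝ) ^ j := by positivity
  calc kerQ L j x κ y μ + Θ j * (L : ℝ) ^ j * kerQdd L j x κ y μ
      ≤ (L : ℝ) ^ j * kerQdd L j x κ y μ + Θ j * (L : ℝ) ^ j * kerQdd L j x κ y μ := add_le_add h1 le_rfl
    _ = (1 + Θ j) * ((L : ℝ) ^ j * kerQdd L j x κ y μ) := by ring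
    _ ≤ (1 + Θ j) * ((L : ℝ) ^ j * (((L : ℝ) ^ j) ^ d)⁻¹) :=
        mul_le_mul_of_nonneg_left (mul_le_mul_of_nonneg_left h2 hLj) (by positivity)

include hL hε hτ hΘ h139 hstep in
/-- **LOCALITY OF THE COMPOSED LINEAR PART AT THE COMPLEX BACKGROUND** — the kernel `Q_j(W; c, b)` vanishes unless `b ⊂ Bʲ(c₋) ∪
Bʲ(c₊)` (Prop. 4/7: «an analytic function of the variables A_b, b ⊂ B^k(c₋) ∪ B^k(c₊)»). [cite: Balaban1985Averaging, Prop. 4 p.38, (147) p.40, Proposition 7 p.43] -/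
theorem linCovIter_bump_eq_zero_cplx (y : Site d) (μ : Fin d) (X : 𝔸) {j : ℕ} (hj : j ≤ k) (x : Site d) (κ : Fin d)
    (hb : ¬ BondIn (loK L j x) (bondHiK L j x κ) y μ) : linCovIter L W (bump y μ X) j x κ = 0 := by
  have h := ineq143_cplx L hL W k hε hτ hΘ h139 hstep y μ X j hj x κ
  rw [kerQ_of_not_bondIn hb, kerQdd_of_not_bondIn hb, mul_zero, zero_add, zero_mul] at h
  exact norm_le_zero_iff.1 h

end Levels

end Literature.MathematicalPhysics.QuantumFieldTheory.Balaban1983to89.B7Prop5CplxLinear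

end
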